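import Literature.Algebra.Semigroups.FullTransformationGreen

/-!
# Cardinalities of principal ideals and of Green classes in `𝒯ₙ`

Source: O. Ganyushkin, V. Mazorchuk, *Classical Finite Transformation Semigroups*, Algebra and
Applications 9, Springer (2009) [GanyushkinMazorchuk2009], §4.2 (Corollaries 4.2.2 (ii), 4.2.3,
4.2.7, 4.2.9) and §4.6 (Proposition 4.6.1 (i), Proposition 4.6.3, Theorem 4.6.6,
Corollary 4.6.7 (i)) — the `𝒯ₙ` column of each statement, for the full transformation monoid
`𝒯(X) = (X → X, ∘)` of a finite type `X` with `n = Nat.card X` elements.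

Conventions are those of `Literature.Algebra.Semigroups.FullTransformationGreen`: `im α` is
`Set.range α`, `rank α = (Set.range α).ncard`, the principal right ideal `α𝒯(X)` is the set
`{β | ∃ γ, β = α ∘ γ}`, the principal left ideal `𝒯(X)α` is `{β | ∃ γ, β = γ ∘ α}` and the
principal two-sided ideal is `{β | ∃ γ δ, β = γ ∘ α ∘ δ}`.

* Corollary 4.2.3: `|α𝒯ₙ| = kⁿ` for `rank α = k` (`ncard_principalRight`);
* Corollary 4.2.7: `|𝒯ₙα| = nᵏ` (`ncard_principalLeft`);
* Corollary 4.2.2 (ii) / Proposition 4.6.1 (i): `𝒯ₙ` has `2ⁿ - 1` principal right ideals,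
  equivalently `2ⁿ - 1` `𝓡`-classes = possible images (`range_range_eq`,
  `ncard_principalRightIdeals`);
* Corollary 4.2.9 / Proposition 4.6.1 (i): `𝒯ₙ` has `n` principal two-sided ideals, the
  possible ranks being `1, …, n` (`range_rank_eq_Icc`, `ncard_principalIdeals`);
* Proposition 4.6.3: the `𝓡`-classes inside `𝓓ₖ` correspond to the `k`-subsets: there are
  `n.choose k` possible images of rank `k` (`ncard_setOf_range_ncard_eq`);
* Theorem 4.6.6: every `𝓗`-class inside `𝓓ₖ` has `k!` elements (`ncard_greenHClass`);
* Corollary 4.6.7 (i): every `𝓛`-class inside `𝓓ₖ` has `(n choose k) · k!` elements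
  (`ncard_greenLClass`).

The Bell-number / Stirling-number counts (Corollary 4.2.5, 4.2.10, Proposition 4.6.2, 4.6.4,
4.6.5 (ii)–(iii), Corollary 4.6.7 (ii)) are not typed here.
-/

namespace Literature.Algebra.Semigroups.FullTransformation

open Function Set
open scoped Nat

variable {X : Type*}

/-! ### Corollaries 4.2.3 and 4.2.7: sizes of principal one-sided ideals -/

/-- The principal right ideal `α𝒯(X)` is the set of maps into `im α`: it is the (injective)
image of `X → im α` under composition with the inclusion.
[cite: GanyushkinMazorchuk2009, Corollary 4.2.3] -/
theorem setOf_exists_eq_comp_eq_range (α : X → X) :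
    {β : X → X | ∃ γ, β = α ∘ γ} = range (fun g : X → range α => Subtype.val ∘ g) := by
  ext β
  rw [mem_setOf_eq, exists_eq_comp_iff_range_subset, mem_range]
  constructor
  · intro hβ
    exact ⟨fun x => ⟨β x, hβ (mem_range_self x)⟩, rfl⟩
  · rintro ⟨g, rfl⟩
    rintro _ ⟨x, rfl⟩
    exact (g x).2

/-- **Corollary 4.2.3** (case `𝒯ₙ`): if `rank α = k` then `|α𝒯ₙ| = kⁿ`: the principal right
ideal consists of all maps from `X` to the `k`-set `im α`.
[cite: GanyushkinMazorchuk2009, Corollary 4.2.3] -/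
theorem ncard_principalRight [Finite X] (α : X → X) :
    {β : X → X | ∃ γ, β = α ∘ γ}.ncard = (range α).ncard ^ Nat.card X := by
  rw [setOf_exists_eq_comp_eq_range, ncard_range_of_injective, Nat.card_fun, Nat.card_coe_set_eq]
  intro g g' hgg'
  funext x
  exact Subtype.ext (congrFun hgg' x)

/-- The principal left ideal `𝒯(X)α` is the set of maps factoring through the kernel of `α`:
it is the (injective) image of `im α → X` under `e ↦ e ∘ α`.
[cite: GanyushkinMazorchuk2009, Corollary 4.2.7] -/
theorem setOf_exists_eq_comp_left_eq_range (α : X → X) :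
    {β : X → X | ∃ γ, β = γ ∘ α} = range (fun e : range α → X => e ∘ rangeFactorization α) := by
  ext β
  simp only [mem_setOf_eq, mem_range]
  constructor
  · rintro ⟨γ, rfl⟩
    exact ⟨γ ∘ Subtype.val, rfl⟩
  · rintro ⟨e, rfl⟩
    refine (exists_eq_comp_left_iff α _).2 fun x y hxy => ?_
    simp only [comp_apply]
    rw [(rangeFactorization_eq_rangeFactorization_iff x y).2 hxy]

/-- **Corollary 4.2.7** (case `𝒯ₙ`): if `rank α = k` then `|𝒯ₙα| = nᵏ`: an element of the
principal left ideal is determined by its (arbitrary) values on the `k` kernel classes of `α`.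
[cite: GanyushkinMazorchuk2009, Corollary 4.2.7] -/
theorem ncard_principalLeft [Finite X] (α : X → X) :
    {β : X → X | ∃ γ, β = γ ∘ α}.ncard = Nat.card X ^ (range α).ncard := by
  rw [setOf_exists_eq_comp_left_eq_range, ncard_range_of_injective, Nat.card_fun,
    Nat.card_coe_set_eq]
  intro e e' hee'
  funext z
  obtain ⟨x, rfl⟩ := rangeFactorization_surjective z
  exact congrFun hee' x

/-! ### Corollary 4.2.2 (ii), Proposition 4.6.1 (i): images and principal right ideals -/

/-- In `𝒯(X)` with `X` nonempty the possible images `im α` are exactly the nonempty subsets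
(the `𝓡`-classes of `𝒯ₙ`, Proposition 4.6.1 (i), via Theorem 4.5.1 (i)).
[cite: GanyushkinMazorchuk2009, Proposition 4.6.1 (i)] -/
theorem range_range_eq [Nonempty X] :
    range (fun α : X → X => range α) = {A : Set X | A.Nonempty} := by
  classical
  ext A
  simp only [mem_range, mem_setOf_eq]
  constructor
  · rintro ⟨α, rfl⟩
    exact range_nonempty α
  · rintro ⟨a, ha⟩
    refine ⟨fun x => if x ∈ A then x else a, Subset.antisymm ?_ fun x hx => ⟨x, by simp [hx]⟩⟩
    rintro _ ⟨x, rfl⟩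
    dsimp only
    split_ifs with hx
    · exact hx
    · exact ha

/-- A finite type with `n` elements has `2ⁿ - 1` nonempty subsets. [folklore] -/
private theorem ncard_setOf_nonempty [Finite X] :
    {A : Set X | A.Nonempty}.ncard = 2 ^ Nat.card X - 1 := by
  classical
  haveI := Fintype.ofFinite X
  have h : {A : Set X | A.Nonempty} = ({∅} : Set (Set X))ᶜ := by
    ext A
    simp [nonempty_iff_ne_empty]
  rw [h, ncard_compl, ncard_singleton, Nat.card_eq_fintype_card, Fintype.card_set,
    Nat.card_eq_fintype_card]

/-- **Corollary 4.2.2 (ii)** (and Proposition 4.6.1 (i), `𝓡`-classes): the full transformation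
semigroup `𝒯ₙ` (`n ≥ 1`) has exactly `2ⁿ - 1` different principal right ideals — one for each
nonempty subset `im α ⊆ X`. [cite: GanyushkinMazorchuk2009, Corollary 4.2.2 (ii)] -/
theorem ncard_principalRightIdeals [Finite X] [Nonempty X] :
    {I : Set (X → X) | ∃ α : X → X, I = {β | ∃ γ, β = α ∘ γ}}.ncard = 2 ^ Nat.card X - 1 := by
  -- the principal right ideal of `α` only depends on `im α`, injectively
  let Φ : Set X → Set (X → X) := fun A => {β | range β ⊆ A}
  have hΦ : ∀ α : X → X, {β : X → X | ∃ γ, β = α ∘ γ} = Φ (range α) := fun α => by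
    ext β; exact exists_eq_comp_iff_range_subset α β
  have hset : {I : Set (X → X) | ∃ α : X → X, I = {β | ∃ γ, β = α ∘ γ}} =
      Φ '' {A : Set X | A.Nonempty} := by
    rw [← range_range_eq, ← range_comp]
    ext I
    simp only [mem_setOf_eq, mem_range, comp_apply, hΦ]
    constructor
    · rintro ⟨α, rfl⟩; exact ⟨α, rfl⟩
    · rintro ⟨α, rfl⟩; exact ⟨α, rfl⟩
  have hinj : InjOn Φ {A : Set X | A.Nonempty} := by
    intro A hA B hB hAB
    obtain ⟨α, (hα : range α = A)⟩ := (range_range_eq (X := X)).symm.subset hA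
    obtain ⟨β, (hβ : range β = B)⟩ := (range_range_eq (X := X)).symm.subset hB
    have h1 : α ∈ Φ B := hAB ▸ (hα.le : range α ⊆ A)
    have h2 : β ∈ Φ A := hAB.symm ▸ (hβ.le : range β ⊆ B)
    exact Subset.antisymm (hα ▸ h1) (hβ ▸ h2)
  rw [hset, hinj.ncard_image, ncard_setOf_nonempty]

/-! ### Corollary 4.2.9, Proposition 4.6.1 (i): ranks and principal two-sided ideals -/

/-- In `𝒯(X)`, `X` finite and nonempty with `n` elements, the possible ranks are exactly
`1, …, n` (the `𝓓`-classes `𝓓₁, …, 𝓓ₙ` of `𝒯ₙ`, §4.6).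
[cite: GanyushkinMazorchuk2009, Proposition 4.6.1 (i)] -/
theorem range_rank_eq_Icc [Finite X] [Nonempty X] :
    range (fun α : X → X => (range α).ncard) = Icc 1 (Nat.card X) := by
  classical
  ext k
  simp only [mem_range, mem_Icc]
  constructor
  · rintro ⟨α, rfl⟩
    exact ⟨Nat.one_le_iff_ne_zero.2 ((ncard_pos (toFinite _)).2 (range_nonempty α)).ne',
      ncard_le_card _⟩
  · rintro ⟨h1, hn⟩
    obtain ⟨A, -, hA⟩ := exists_subset_card_eq (s := (univ : Set X)) (n := k) (by simpa using hn)
    have hAne : A.Nonempty := (ncard_pos (toFinite A)).1 (hA ▸ h1)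
    obtain ⟨α, (hα : range α = A)⟩ := (range_range_eq (X := X)).symm.subset hAne
    exact ⟨α, by rw [hα, hA]⟩

/-- **Corollary 4.2.9** (and Proposition 4.6.1 (i), `𝓙`-classes): `𝒯ₙ` (`n ≥ 1`) contains
exactly `n` different principal two-sided ideals, `𝓘ₖ = {β : rank β ≤ k}` for `k = 1, …, n`.
[cite: GanyushkinMazorchuk2009, Corollary 4.2.9] -/
theorem ncard_principalIdeals [Finite X] [Nonempty X] :
    {I : Set (X → X) | ∃ α : X → X, I = {β | ∃ γ δ, β = γ ∘ α ∘ δ}}.ncard = Nat.card X := by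
  let Φ : ℕ → Set (X → X) := fun k => {β | (range β).ncard ≤ k}
  have hΦ : ∀ α : X → X, {β : X → X | ∃ γ δ, β = γ ∘ α ∘ δ} = Φ (range α).ncard := fun α => by
    ext β; exact exists_eq_comp_comp_iff_ncard_le α β
  have hset : {I : Set (X → X) | ∃ α : X → X, I = {β | ∃ γ δ, β = γ ∘ α ∘ δ}} =
      Φ '' Icc 1 (Nat.card X) := by
    rw [← range_rank_eq_Icc, ← range_comp]
    ext I
    simp only [mem_setOf_eq, mem_range, comp_apply, hΦ]
    constructor
    · rintro ⟨α, rfl⟩; exact ⟨α, rfl⟩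
    · rintro ⟨α, rfl⟩; exact ⟨α, rfl⟩
  have hinj : InjOn Φ (Icc 1 (Nat.card X)) := by
    intro k hk l hl hkl
    obtain ⟨α, (hα : (range α).ncard = k)⟩ := (range_rank_eq_Icc (X := X)).symm.subset hk
    obtain ⟨β, (hβ : (range β).ncard = l)⟩ := (range_rank_eq_Icc (X := X)).symm.subset hl
    have h1 : α ∈ Φ l := hkl ▸ (hα.le : (range α).ncard ≤ k)
    have h2 : β ∈ Φ k := hkl.symm ▸ (hβ.le : (range β).ncard ≤ l)
    exact le_antisymm (hα ▸ h1) (hβ ▸ h2)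
  rw [hset, hinj.ncard_image, ← Finset.coe_Icc, ncard_coe_finset, Nat.card_Icc, Nat.add_sub_cancel]

/-! ### Proposition 4.6.3: `𝓡`-classes inside `𝓓ₖ` -/

/-- **Proposition 4.6.3** (case `𝒯ₙ`): the `𝓡`-classes inside `𝓓ₖ`, i.e. the possible images
of rank `k` (`1 ≤ k`), are all the `k`-element subsets; there are `n.choose k` of them.
[cite: GanyushkinMazorchuk2009, Proposition 4.6.3] -/
theorem ncard_setOf_range_ncard_eq [Finite X] {k : ℕ} (hk : 1 ≤ k) :
    {A : Set X | (∃ α : X → X, range α = A) ∧ A.ncard = k}.ncard = (Nat.card X).choose k := by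
  have h : {A : Set X | (∃ α : X → X, range α = A) ∧ A.ncard = k} =
      {A | A ⊆ univ ∧ A.ncard = k} := by
    ext A
    simp only [mem_setOf_eq, subset_univ, true_and, and_iff_right_iff_imp]
    intro hA
    have hAne : A.Nonempty := (ncard_pos (toFinite A)).1 (hA ▸ hk)
    obtain ⟨a, ha⟩ := hAne
    haveI : Nonempty X := ⟨a⟩
    exact (range_range_eq (X := X)).symm.subset ⟨a, ha⟩
  rw [h, ncard_powerset_ncard finite_univ, ncard_univ]

/-! ### Theorem 4.6.6 and Corollary 4.6.7 (i): sizes of `𝓗`- and `𝓛`-classes -/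

/-- **Corollary 4.6.7 (i)** (case `𝒯ₙ`), structural form: the `𝓛`-class of `α` — the maps
with the same kernel partition as `α` (Theorem 4.5.1 (ii)) — is the injective image of the
embeddings `im α ↪ X` under `e ↦ e ∘ α`. [cite: GanyushkinMazorchuk2009, Corollary 4.6.7 (i)] -/
theorem greenLClass_eq_range (α : X → X) :
    {β : X → X | ∀ x y, α x = α y ↔ β x = β y} =
      range (fun e : range α ↪ X => e ∘ rangeFactorization α) := by
  ext β
  simp only [mem_setOf_eq, mem_range]
  constructor
  · intro h
    obtain ⟨e, he⟩ : β ∈ range (fun e : range α → X => e ∘ rangeFactorization α) := by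
      rw [← setOf_exists_eq_comp_left_eq_range]
      exact (exists_eq_comp_left_iff α β).2 fun x y hxy => (h x y).1 hxy
    have hinj : Injective e := by
      intro z z' hzz'
      obtain ⟨x, rfl⟩ := rangeFactorization_surjective z
      obtain ⟨y, rfl⟩ := rangeFactorization_surjective z'
      have : β x = β y := by rw [← he]; exact hzz'
      exact (rangeFactorization_eq_rangeFactorization_iff x y).2 ((h x y).2 this)
    exact ⟨⟨e, hinj⟩, he⟩
  · rintro ⟨e, rfl⟩ x y
    simp only [comp_apply]
    rw [e.injective.eq_iff, rangeFactorization_eq_rangeFactorization_iff]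

/-- **Corollary 4.6.7 (i)** (case `𝒯ₙ`): each `𝓛`-class inside `𝓓ₖ` has exactly
`(n choose k) · k!` elements (the injections of the `k` kernel classes into `X`).
[cite: GanyushkinMazorchuk2009, Corollary 4.6.7 (i)] -/
theorem ncard_greenLClass [Finite X] (α : X → X) :
    {β : X → X | ∀ x y, α x = α y ↔ β x = β y}.ncard =
      (Nat.card X).choose (range α).ncard * (range α).ncard ! := by
  classical
  haveI := Fintype.ofFinite X
  haveI := Fintype.ofFinite (range α)
  rw [greenLClass_eq_range, ncard_range_of_injective, Nat.card_eq_fintype_card,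
    Fintype.card_embedding_eq, Nat.descFactorial_eq_factorial_mul_choose, mul_comm,
    ← Nat.card_eq_fintype_card, ← Nat.card_eq_fintype_card, Nat.card_coe_set_eq]
  intro e e' hee'
  ext z
  obtain ⟨x, rfl⟩ := rangeFactorization_surjective z
  exact congrFun hee' x

/-- **Theorem 4.6.6** (case `𝒯ₙ`), structural form: the `𝓗`-class of `α` — the maps with the
same image and the same kernel partition as `α` (Theorem 4.5.1 (iii)) — is the injective image
of the permutations of `im α` under `σ ↦ σ ∘ α`: an element of the class is "a surjective
function from the set of kernel blocks to `im α`".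
[cite: GanyushkinMazorchuk2009, Theorem 4.6.6] -/
theorem greenHClass_eq_range [Finite X] (α : X → X) :
    {β : X → X | range β = range α ∧ ∀ x y, α x = α y ↔ β x = β y} =
      range (fun σ : Equiv.Perm (range α) => Subtype.val ∘ σ ∘ rangeFactorization α) := by
  ext β
  simp only [mem_setOf_eq, mem_range]
  constructor
  · rintro ⟨hr, hk⟩
    obtain ⟨e, rfl⟩ : β ∈ range (fun e : range α ↪ X => e ∘ rangeFactorization α) := by
      rw [← greenLClass_eq_range]; exact hk
    dsimp only at hr hk
    -- `e` lands in `im α` and is a bijection onto it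
    have hmem : ∀ z, e z ∈ range α := fun z => by
      obtain ⟨x, rfl⟩ := rangeFactorization_surjective z
      have h1 : e (rangeFactorization α x) ∈ range (⇑e ∘ rangeFactorization α) := ⟨x, rfl⟩
      rwa [hr] at h1
    let g : range α → range α := fun z => ⟨e z, hmem z⟩
    have hg : Injective g := fun z z' h => e.injective (congrArg Subtype.val h)
    refine ⟨Equiv.ofBijective g (Finite.injective_iff_bijective.1 hg), rfl⟩
  · rintro ⟨σ, rfl⟩
    refine ⟨Subset.antisymm ?_ ?_, fun x y => ?_⟩
    · rintro _ ⟨x, rfl⟩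
      exact (σ (rangeFactorization α x)).2
    · rintro _ ⟨x, rfl⟩
      obtain ⟨y, hy⟩ := rangeFactorization_surjective (σ.symm (rangeFactorization α x))
      refine ⟨y, ?_⟩
      simp only [comp_apply, hy, Equiv.apply_symm_apply, rangeFactorization_coe]
    · simp only [comp_apply]
      rw [Subtype.val_injective.eq_iff, σ.injective.eq_iff,
        rangeFactorization_eq_rangeFactorization_iff]

/-- **Theorem 4.6.6** (case `𝒯ₙ`): every `𝓗`-class inside the `𝓓`-class `𝓓ₖ` has exactly `k!`
elements. [cite: GanyushkinMazorchuk2009, Theorem 4.6.6] -/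
theorem ncard_greenHClass [Finite X] (α : X → X) :
    {β : X → X | range β = range α ∧ ∀ x y, α x = α y ↔ β x = β y}.ncard =
      (range α).ncard ! := by
  classical
  haveI := Fintype.ofFinite (range α)
  rw [greenHClass_eq_range, ncard_range_of_injective, Nat.card_eq_fintype_card,
    Fintype.card_perm, ← Nat.card_eq_fintype_card, Nat.card_coe_set_eq]
  intro σ σ' h
  ext z
  obtain ⟨x, rfl⟩ := rangeFactorization_surjective z
  exact congrFun h x

end Literature.Algebra.Semigroups.FullTransformation
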